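import Summits.CriticalPhenomena.PercolationContinuityZ3.Theorems.PercNearOneGluingNoHeavyQuantSliceHeavyFlows
import Summits.CriticalPhenomena.PercolationContinuityZ3.Theorems.PercNearOneGluingNoHeavyQuantSDEC
import HarnessLib

/-!
# QUANT lane R8, T-DEC: CONVOLUTION CLOSURE OF DEC IN THE HEAVY WORLD — if `μ₂` has a heavy DEC(j′) datum and `μ₁` has heavy data at
# every layer `≤ j′`, then `lconv μ₁ μ₂` is DEC(j′) at the sum of the targets (first kernel conv-closure statement beyond blobs)

builds on p205010 (kernel theorem, internal audit signed; external expert review pending)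

Support file (`--supports stmt-CriticalPhenomena-4575`), QUANT lane typer seat prim-quant-stmt (gen 22), rung R8 of
`run/shared/lean/prim/quant/LADDER.md`.  Theorems only, standard axioms, no sorries.  Uses typer g22's `…QuantSliceHeavy`
(`slice_decAtT_of_hdecAtT`), `…QuantSliceHeavyFlows` (`hflowAtT_of_giantsAbsorbLows`, `hdecAtT_of_hflowAtT`), `…QuantDECAtTMixtures`
(`decAtT_shift_two`, `decAtT_finite_mixture`) and census-2 g53's `LawDec.lconv` (`…QuantSDEC`).

THE THEOREM (`LawDec.lconv_decAtT_of_hdecAtT`).  Floor `0 < x < 1`; `μ₁ ≥ 0` a law on `{0..M₁}` (mass 1) with HEAVY DEC data `HDECAtT x T₁ j″ M₁ μ₁`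
for every `j″ ≤ j′`; `μ₂` with a heavy datum `HDECAtT x T₂ j′ M₂ μ₂`.  Then `DECAtT x (T₁ + T₂) j′ (M₁ + M₂) (lconv M₁ M₂ μ₁ μ₂)`.
TERM-WISE over `μ₂`'s datum (LEAD-NOTES-G20 N42 (3): "per-TERM certification is NOT complete" — it IS complete in the heavy world):
`lconv μ₁ {lo, hi; γ} = (1−γ)·shift_lo μ₁ + γ·shift_hi μ₁ = shift_lo (slice μ₁ (hi−lo) γ)` (`lconv_TP`); an (S) point `k` gives `shift_k μ₁`, DEC(j′) at
target `T₁ + 2k ≥ T₁ + T₂` by the double shift bonus (or all giants if `k > j′`); a (G) pair is criterion E inside the term (`x(1−γ) ≤ (1−x)γ`); a heavy (N)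
pair is SL-for-heavy-data at layer `j′ − lo` (`slice_decAtT_of_hdecAtT`) shifted by `lo`: target `T₁ + (hi−lo)γ + 2lo ≥ T₁ + T₂`.  The LIGHT components
of `μ₂` are exactly what this cannot do (FOR-PROVERS-SL §4: the light slice at the discounted target is false), which is why `SDECConvClosed` is open.
COROLLARY `lconv_decAt_of_hdecAt` (at the means).  In particular: two laws certified by criterion E (μ₁ at every layer ≤ j′, μ₂ at j′) have a DEC(j′)
convolution — the E-bulk of census-2's CONV census (DEC-CLOSURE-G53 §2) is now kernel.
HONEST: `SDECConvClosed`, `SliceClosed`, `TreeBuiltDEC`, `FarTreeRow` remain OPEN; the output datum here may contain light pairs (BLOB-DEC(2)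
inside `slice_decAtT_of_hdecAtT`), so the theorem does not iterate by itself.

[this work]; DEC rules ARCH-TREES-G49 §2.2 / DEC-TAMP-G50 §3.1, DEC-CLOSURE-G53 §0 (2)/§3, LEAD-NOTES-G20 N42 (this lane).  The gluing rows served
[cite: KozmaNitzan2024, Conjecture 3 (p. 15)]; product measure [cite: Grimmett1999, §1.3 p. 10].
-/

noncomputable section

namespace Summit.CriticalPhenomena.PercolationContinuityZ3.Theorems

namespace Quant

open Finset

/-- the two-point law `{lo, hi; g}` (as in `…QuantLawDEC`) -/
local notation3 "TP[" lo ", " hi ", " g ", " h "]" =>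
  (g : ℝ) * (if (h : ℕ) = (hi : ℕ) then (1 : ℝ) else 0) + (1 - (g : ℝ)) * (if (h : ℕ) = (lo : ℕ) then (1 : ℝ) else 0)

/-- the law `μ` shifted up by `s` -/
local notation3 "SH[" μ ", " s ", " h "]" => (if (s : ℕ) ≤ (h : ℕ) then (μ : ℕ → ℝ) ((h : ℕ) - (s : ℕ)) else (0 : ℝ))

namespace LawDec

/-! ### Shift and convolution bookkeeping -/

/-- a shifted law vanishes above `M₁ + s` (if `μ₁` vanishes above `M₁`) and, a fortiori, above any `M ≥ M₁ + s`. [this work] -/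
theorem shift_eq_zero (μ₁ : ℕ → ℝ) (M₁ s M : ℕ) (h1M : ∀ h, M₁ < h → μ₁ h = 0) (hsM : s + M₁ ≤ M) (h : ℕ) (hh : M < h) :
    SH[μ₁, s, h] = 0 := by
  split_ifs with hs
  · exact h1M _ (by omega)
  · rfl

/-- a shifted law of mass `1` has mass `1` on `{0..M}` for `M ≥ M₁ + s`. [this work] -/
theorem sum_shift_range (μ₁ : ℕ → ℝ) (M₁ s M : ℕ) (h1M : ∀ h, M₁ < h → μ₁ h = 0)
    (h11 : ∑ h ∈ Finset.range (M₁ + 1), μ₁ h = 1) (hsM : s + M₁ ≤ M) :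
    ∑ h ∈ Finset.range (M + 1), SH[μ₁, s, h] = 1 := by
  obtain ⟨d, hd⟩ : ∃ d, M = M₁ + s + d := ⟨M - (M₁ + s), by omega⟩
  rw [hd, sum_range_extend (fun h => SH[μ₁, s, h]) (M₁ + s) d (fun h hh => by
      show SH[μ₁, s, h] = 0
      split_ifs with hs
      · exact h1M _ (by omega)
      · rfl),
    sum_shift μ₁ M₁ s, h11]

/-- partial sums of a shifted nonnegative law of mass `1` are `≤ 1`. [this work] -/
theorem sum_shift_le_one (μ₁ : ℕ → ℝ) (M₁ s N : ℕ) (h10 : ∀ h, 0 ≤ μ₁ h) (h1M : ∀ h, M₁ < h → μ₁ h = 0)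
    (h11 : ∑ h ∈ Finset.range (M₁ + 1), μ₁ h = 1) : ∑ h ∈ Finset.range N, SH[μ₁, s, h] ≤ 1 := by
  have hnn : ∀ h, 0 ≤ SH[μ₁, s, h] := fun h => by split_ifs <;> [exact h10 _; exact le_rfl]
  have htot := sum_shift_range μ₁ M₁ s (max N (s + M₁)) h1M h11 (le_max_right _ _)
  calc ∑ h ∈ Finset.range N, SH[μ₁, s, h] ≤ ∑ h ∈ Finset.range (max N (s + M₁) + 1), SH[μ₁, s, h] :=
        Finset.sum_le_sum_of_subset_of_nonneg (Finset.range_subset_range.2 (by omega)) fun h _ _ => hnn h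
    _ = 1 := htot

/-- **convolution with a two-point law**: `lconv μ₁ {lo, hi; γ} = (1−γ)·shift_lo μ₁ + γ·shift_hi μ₁` (for `μ₁` vanishing above `M₁` and
`lo, hi ≤ M₂`). [this work] -/
theorem lconv_TP (M₁ M₂ lo hi : ℕ) (μ₁ : ℕ → ℝ) (γ : ℝ) (h1M : ∀ h, M₁ < h → μ₁ h = 0) (hlo : lo ≤ M₂) (hhi : hi ≤ M₂) (h : ℕ) :
    lconv M₁ M₂ μ₁ (fun k => TP[lo, hi, γ, k]) h = (1 - γ) * SH[μ₁, lo, h] + γ * SH[μ₁, hi, h] := by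
  simp only [lconv]
  have inner : ∀ i : ℕ, ∑ k ∈ Finset.range (M₂ + 1), (if i + k = h then μ₁ i * TP[lo, hi, γ, k] else 0)
      = μ₁ i * (γ * (if i + hi = h then (1 : ℝ) else 0) + (1 - γ) * (if i + lo = h then (1 : ℝ) else 0)) := by
    intro i
    have e : ∀ k : ℕ, (if i + k = h then μ₁ i * TP[lo, hi, γ, k] else 0)
        = μ₁ i * γ * (if k = hi then (if i + k = h then (1 : ℝ) else 0) else 0)
          + μ₁ i * (1 - γ) * (if k = lo then (if i + k = h then (1 : ℝ) else 0) else 0) := by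
      intro k
      split_ifs <;> ring
    simp_rw [e]
    rw [Finset.sum_add_distrib, ← Finset.mul_sum, ← Finset.mul_sum, Finset.sum_ite_eq' (Finset.range (M₂ + 1)) hi,
      Finset.sum_ite_eq' (Finset.range (M₂ + 1)) lo, if_pos (Finset.mem_range.2 (Nat.lt_succ_of_le hhi)),
      if_pos (Finset.mem_range.2 (Nat.lt_succ_of_le hlo))]
    ring
  simp_rw [inner]
  have e2 : ∀ i : ℕ, μ₁ i * (γ * (if i + hi = h then (1 : ℝ) else 0) + (1 - γ) * (if i + lo = h then (1 : ℝ) else 0))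
      = (1 - γ) * (μ₁ i * (if h - lo = i ∧ lo ≤ h then (1 : ℝ) else 0)) + γ * (μ₁ i * (if h - hi = i ∧ hi ≤ h then (1 : ℝ) else 0)) := by
    intro i
    have h1 : (i + hi = h) ↔ (h - hi = i ∧ hi ≤ h) := by omega
    have h2 : (i + lo = h) ↔ (h - lo = i ∧ lo ≤ h) := by omega
    simp only [h1, h2]
    ring
  simp_rw [e2]
  rw [Finset.sum_add_distrib, ← Finset.mul_sum, ← Finset.mul_sum]
  have s1 : ∀ s : ℕ, ∑ i ∈ Finset.range (M₁ + 1), μ₁ i * (if h - s = i ∧ s ≤ h then (1 : ℝ) else 0) = SH[μ₁, s, h] := by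
    intro s
    by_cases hs : s ≤ h
    · have e3 : ∀ i : ℕ, (μ₁ i * if h - s = i ∧ s ≤ h then (1 : ℝ) else 0) = μ₁ i * (if h - s = i then (1 : ℝ) else 0) := by
        intro i; simp [hs]
      simp_rw [e3]
      rw [sum_indicator μ₁ (M₁ + 1) (h - s), if_pos hs]
      split_ifs with hh
      · rfl
      · exact (h1M (h - s) (by omega)).symm
    · rw [if_neg hs]
      refine Finset.sum_eq_zero fun i _ => ?_
      rw [if_neg (fun hc => hs hc.2), mul_zero]
  rw [s1 lo, s1 hi]

/-- the shift of a slice: `shift_lo (slice μ₁ b γ) = (1−γ)·shift_lo μ₁ + γ·shift_{lo+b} μ₁`. [this work] -/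
theorem shift_slice (μ₁ : ℕ → ℝ) (lo b : ℕ) (γ : ℝ) (h : ℕ) :
    (if lo ≤ h then slice μ₁ b γ (h - lo) else 0) = (1 - γ) * SH[μ₁, lo, h] + γ * SH[μ₁, lo + b, h] := by
  by_cases hlo : lo ≤ h
  · rw [if_pos hlo, if_pos hlo]
    simp only [slice]
    by_cases hb : lo + b ≤ h
    · rw [if_pos (by omega : b ≤ h - lo), if_pos hb, show h - lo - b = h - (lo + b) by omega]
    · rw [if_neg (by omega : ¬ b ≤ h - lo), if_neg hb]
  · rw [if_neg hlo, if_neg hlo, if_neg (by omega)]; ring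

/-- `lconv` is linear in its second argument (finite mixtures). [this work] -/
theorem lconv_sum_right {ρ : Type} [Fintype ρ] (M₁ M₂ : ℕ) (μ₁ : ℕ → ℝ) (lam : ρ → ℝ) (ν : ρ → ℕ → ℝ) (h : ℕ) :
    lconv M₁ M₂ μ₁ (fun k => ∑ r, lam r * ν r k) h = ∑ r, lam r * lconv M₁ M₂ μ₁ (ν r) h := by
  simp only [lconv]
  calc ∑ i ∈ Finset.range (M₁ + 1), ∑ k ∈ Finset.range (M₂ + 1), (if i + k = h then μ₁ i * ∑ r, lam r * ν r k else 0)
      = ∑ i ∈ Finset.range (M₁ + 1), ∑ k ∈ Finset.range (M₂ + 1), ∑ r, lam r * (if i + k = h then μ₁ i * ν r k else 0) := by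
        refine Finset.sum_congr rfl fun i _ => Finset.sum_congr rfl fun k _ => ?_
        split_ifs
        · rw [Finset.mul_sum]; exact Finset.sum_congr rfl fun r _ => by ring
        · simp
    _ = ∑ i ∈ Finset.range (M₁ + 1), ∑ r, ∑ k ∈ Finset.range (M₂ + 1), lam r * (if i + k = h then μ₁ i * ν r k else 0) :=
        Finset.sum_congr rfl fun i _ => Finset.sum_comm
    _ = ∑ r, ∑ i ∈ Finset.range (M₁ + 1), ∑ k ∈ Finset.range (M₂ + 1), lam r * (if i + k = h then μ₁ i * ν r k else 0) :=
        Finset.sum_comm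
    _ = ∑ r, lam r * ∑ i ∈ Finset.range (M₁ + 1), ∑ k ∈ Finset.range (M₂ + 1), (if i + k = h then μ₁ i * ν r k else 0) := by
        refine Finset.sum_congr rfl fun r _ => ?_
        rw [Finset.mul_sum]
        exact Finset.sum_congr rfl fun i _ => by rw [Finset.mul_sum]

/-! ### The three kinds of terms -/

/-- **a law carried by giants is DEC at any target**: `μ ≥ 0` on `{0..M}` (mass 1) vanishing on `{0..j′}` has the empty heavy flow. [this work] -/
theorem decAtT_of_allGiants (x T : ℝ) (j' M : ℕ) (μ : ℕ → ℝ) (hx0 : 0 < x) (hx1 : x < 1) (hμ0 : ∀ h, 0 ≤ μ h)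
    (hμM : ∀ h, M < h → μ h = 0) (hμ1 : ∑ h ∈ Finset.range (M + 1), μ h = 1) (hlow : ∀ h, h ≤ j' → μ h = 0) :
    DECAtT x T j' M μ := by
  refine (hdecAtT_of_hflowAtT x T j' M μ hx0 hx1 hμM hμ1 (hflowAtT_of_giantsAbsorbLows x T j' M μ hx0 hx1 hμ0 ?_)).decAtT
  have hz : ∑ l ∈ Finset.range (j' + 1), (if 2 * (l : ℝ) < T then μ l else 0) = 0 :=
    Finset.sum_eq_zero fun l hl => by
      rw [hlow l (Nat.lt_succ_iff.1 (Finset.mem_range.1 hl))]; split_ifs <;> rfl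
  rw [hz, mul_zero]
  exact mul_nonneg (by linarith) (Finset.sum_nonneg fun h _ => hμ0 h)

/-- **(S)-term**: `shift_k μ₁` is DEC(j′) at target `T₁ + T₂` when `k` is self-sufficient for `(T₂, j′)` — by the double shift bonus from a
(heavy) datum of `μ₁` at layer `j′ − k` (`k ≤ j′`, `T₂ ≤ 2k`), or because it is carried by giants (`k > j′`). [this work] -/
theorem shift_point_decAtT (x T₁ T₂ : ℝ) (j' M₁ M₂ k : ℕ) (μ₁ : ℕ → ℝ) (hx0 : 0 < x) (hx1 : x < 1) (h10 : ∀ h, 0 ≤ μ₁ h)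
    (h1M : ∀ h, M₁ < h → μ₁ h = 0) (h11 : ∑ h ∈ Finset.range (M₁ + 1), μ₁ h = 1) (hkM : k ≤ M₂)
    (hμ₁ : ∀ j'', j'' ≤ j' → HDECAtT x T₁ j'' M₁ μ₁) (hS : T₂ ≤ 2 * (k : ℝ) ∨ j' + 1 ≤ k) :
    DECAtT x (T₁ + T₂) j' (M₁ + M₂) (fun h => SH[μ₁, k, h]) := by
  by_cases hkj : k ≤ j'
  · have h2k : T₂ ≤ 2 * (k : ℝ) := by
      rcases hS with h | h
      · exact h
      · omega
    have hd := decAtT_shift_two x T₁ (j' - k) M₁ k μ₁ (hμ₁ (j' - k) (by omega)).decAtT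
    rw [show j' - k + k = j' by omega] at hd
    exact decAtT_antitone_target (by linarith) (decAtT_mono_top hd (by omega))
  · exact decAtT_of_allGiants x _ j' (M₁ + M₂) _ hx0 hx1 (fun h => by split_ifs <;> [exact h10 _; exact le_rfl])
      (shift_eq_zero μ₁ M₁ k (M₁ + M₂) h1M (by omega)) (sum_shift_range μ₁ M₁ k (M₁ + M₂) h1M h11 (by omega))
      (fun h hh => by rw [if_neg (by omega)])

/-- **(G)-term**: `(1−γ)·shift_lo μ₁ + γ·shift_hi μ₁` with `hi ≥ j′+1`, `x ≤ γ ≤ 1` is DEC(j′) at any target: criterion E inside the term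
(low mass `≤ 1−γ`, giant mass `≥ γ`, `x(1−γ) ≤ (1−x)γ`). [this work] -/
theorem shift_giant_decAtT (x T : ℝ) (j' M₁ M₂ lo hi : ℕ) (μ₁ : ℕ → ℝ) (γ : ℝ) (hx0 : 0 < x) (hx1 : x < 1)
    (h10 : ∀ h, 0 ≤ μ₁ h) (h1M : ∀ h, M₁ < h → μ₁ h = 0) (h11 : ∑ h ∈ Finset.range (M₁ + 1), μ₁ h = 1)
    (hlo : lo ≤ M₂) (hhi : hi ≤ M₂) (hj : j' + 1 ≤ hi) (hxγ : x ≤ γ) (hγ1 : γ ≤ 1) :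
    DECAtT x T j' (M₁ + M₂) (fun h => (1 - γ) * SH[μ₁, lo, h] + γ * SH[μ₁, hi, h]) := by
  have hnnlo : ∀ h, 0 ≤ SH[μ₁, lo, h] := fun h => by split_ifs <;> [exact h10 _; exact le_rfl]
  have hnnhi : ∀ h, 0 ≤ SH[μ₁, hi, h] := fun h => by split_ifs <;> [exact h10 _; exact le_rfl]
  have hν0 : ∀ h, 0 ≤ (1 - γ) * SH[μ₁, lo, h] + γ * SH[μ₁, hi, h] :=
    fun h => add_nonneg (mul_nonneg (by linarith) (hnnlo h)) (mul_nonneg (hx0.le.trans hxγ) (hnnhi h))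
  have hνM : ∀ h, M₁ + M₂ < h → (1 - γ) * SH[μ₁, lo, h] + γ * SH[μ₁, hi, h] = 0 := fun h hh => by
    rw [shift_eq_zero μ₁ M₁ lo (M₁ + M₂) h1M (by omega) h hh, shift_eq_zero μ₁ M₁ hi (M₁ + M₂) h1M (by omega) h hh]; ring
  have hν1 : ∑ h ∈ Finset.range (M₁ + M₂ + 1), ((1 - γ) * SH[μ₁, lo, h] + γ * SH[μ₁, hi, h]) = 1 := by
    rw [Finset.sum_add_distrib, ← Finset.mul_sum, ← Finset.mul_sum, sum_shift_range μ₁ M₁ lo (M₁ + M₂) h1M h11 (by omega),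
      sum_shift_range μ₁ M₁ hi (M₁ + M₂) h1M h11 (by omega)]
    ring
  refine (hdecAtT_of_hflowAtT x T j' (M₁ + M₂) _ hx0 hx1 hνM hν1 (hflowAtT_of_giantsAbsorbLows x T j' (M₁ + M₂) _ hx0 hx1 hν0 ?_)).decAtT
  -- low mass ≤ 1 − γ
  have hL : ∑ l ∈ Finset.range (j' + 1), (if 2 * (l : ℝ) < T then (1 - γ) * SH[μ₁, lo, l] + γ * SH[μ₁, hi, l] else 0) ≤ 1 - γ := by
    have h1 : ∑ l ∈ Finset.range (j' + 1), (if 2 * (l : ℝ) < T then (1 - γ) * SH[μ₁, lo, l] + γ * SH[μ₁, hi, l] else 0)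
        ≤ ∑ l ∈ Finset.range (j' + 1), (1 - γ) * SH[μ₁, lo, l] := by
      refine Finset.sum_le_sum fun l hl => ?_
      have hlj : l ≤ j' := Nat.lt_succ_iff.1 (Finset.mem_range.1 hl)
      have hz : SH[μ₁, hi, l] = 0 := by rw [if_neg (by omega)]
      by_cases h2 : 2 * (l : ℝ) < T
      · rw [if_pos h2, hz, mul_zero, add_zero]
      · rw [if_neg h2]; exact mul_nonneg (by linarith) (hnnlo l)
    rw [← Finset.mul_sum] at h1
    have h2 := sum_shift_le_one μ₁ M₁ lo (j' + 1) h10 h1M h11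
    nlinarith
  -- giant mass ≥ γ
  have hG : γ ≤ ∑ h ∈ Finset.Ico (j' + 1) (M₁ + M₂ + 1), ((1 - γ) * SH[μ₁, lo, h] + γ * SH[μ₁, hi, h]) := by
    have h1 : ∑ h ∈ Finset.Ico (j' + 1) (M₁ + M₂ + 1), γ * SH[μ₁, hi, h]
        ≤ ∑ h ∈ Finset.Ico (j' + 1) (M₁ + M₂ + 1), ((1 - γ) * SH[μ₁, lo, h] + γ * SH[μ₁, hi, h]) :=
      Finset.sum_le_sum fun h _ => by linarith [mul_nonneg (by linarith : (0 : ℝ) ≤ 1 - γ) (hnnlo h)]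
    have h2 : ∑ h ∈ Finset.Ico (j' + 1) (M₁ + M₂ + 1), γ * SH[μ₁, hi, h] = γ := by
      rw [← Finset.mul_sum]
      have hsplit := Finset.sum_range_add_sum_Ico (fun h => SH[μ₁, hi, h]) (show j' + 1 ≤ M₁ + M₂ + 1 by omega)
      have hz : ∑ h ∈ Finset.range (j' + 1), SH[μ₁, hi, h] = 0 :=
        Finset.sum_eq_zero fun h hh => by rw [if_neg (by have := Finset.mem_range.1 hh; omega)]
      rw [hz, zero_add, sum_shift_range μ₁ M₁ hi (M₁ + M₂) h1M h11 (by omega)] at hsplit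
      rw [hsplit, mul_one]
    linarith
  nlinarith [mul_le_mul_of_nonneg_left hL hx0.le, mul_le_mul_of_nonneg_left hG (by linarith : (0 : ℝ) ≤ 1 - x)]

/-- **heavy (N)-term**: `lconv μ₁ {lo, hi; γ} = shift_lo (slice μ₁ (hi−lo) γ)` with `lo < hi ≤ j′`, `x ≤ γ ≤ 1` is DEC(j′) at every target
`T' ≤ T₁ + 2lo + (hi−lo)γ`, given a heavy datum of `μ₁` at layer `j′ − lo` (`slice_decAtT_of_hdecAtT` + the double shift bonus). [this work] -/
theorem shift_heavyPair_decAtT (x T₁ T' : ℝ) (j' M₁ M₂ lo hi : ℕ) (μ₁ : ℕ → ℝ) (γ : ℝ) (hx0 : 0 < x) (hx1 : x < 1)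
    (hlt : lo < hi) (hhij : hi ≤ j') (hhi : hi ≤ M₂) (hxγ : x ≤ γ) (hγ1 : γ ≤ 1)
    (hμ₁ : HDECAtT x T₁ (j' - lo) M₁ μ₁) (hT' : T' ≤ T₁ + 2 * (lo : ℝ) + ((hi : ℝ) - lo) * γ) :
    DECAtT x T' j' (M₁ + M₂) (fun h => (1 - γ) * SH[μ₁, lo, h] + γ * SH[μ₁, hi, h]) := by
  obtain ⟨b, hb⟩ : ∃ b, hi = lo + b := ⟨hi - lo, by omega⟩
  have hsl := slice_decAtT_of_hdecAtT x T₁ γ (j' - lo) M₁ b μ₁ hx0 hx1 hxγ hγ1 (by omega) hμ₁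
  have hsh := decAtT_shift_two x (T₁ + (b : ℝ) * γ) (j' - lo) (M₁ + b) lo _ hsl
  rw [show j' - lo + lo = j' by omega] at hsh
  have hfin := decAtT_antitone_target (show T' ≤ T₁ + (b : ℝ) * γ + 2 * (lo : ℝ) by
    have : ((hi : ℝ) - lo) = b := by rw [hb]; push_cast; ring
    rw [this] at hT'; linarith) (decAtT_mono_top hsh (show M₁ + b + lo ≤ M₁ + M₂ by omega))
  have e : (fun h => if lo ≤ h then slice μ₁ b γ (h - lo) else 0) = fun h => (1 - γ) * SH[μ₁, lo, h] + γ * SH[μ₁, hi, h] := by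
    funext h; rw [shift_slice, hb]
  rw [e] at hfin
  exact hfin

/-! ### The theorem -/

/-- **CONVOLUTION CLOSURE OF DEC IN THE HEAVY WORLD.**  See the file header. [this work] -/
theorem lconv_decAtT_of_hdecAtT (x T₁ T₂ : ℝ) (j' M₁ M₂ : ℕ) (μ₁ μ₂ : ℕ → ℝ) (hx0 : 0 < x) (hx1 : x < 1)
    (h10 : ∀ h, 0 ≤ μ₁ h) (h1M : ∀ h, M₁ < h → μ₁ h = 0) (h11 : ∑ h ∈ Finset.range (M₁ + 1), μ₁ h = 1)
    (hμ₁ : ∀ j'', j'' ≤ j' → HDECAtT x T₁ j'' M₁ μ₁) (hμ₂ : HDECAtT x T₂ j' M₂ μ₂) :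
    DECAtT x (T₁ + T₂) j' (M₁ + M₂) (lconv M₁ M₂ μ₁ μ₂) := by
  classical
  obtain ⟨ρ, hρ, lam, gg, lo, hi, h0, h1, hgg, hlohi, hhi, hμ, hval⟩ := hμ₂
  have hmix : ∀ t, lconv M₁ M₂ μ₁ μ₂ t = ∑ r, lam r * lconv M₁ M₂ μ₁ (fun k => TP[lo r, hi r, gg r, k]) t := by
    intro t
    rw [← lconv_sum_right]
    simp only [lconv]
    refine Finset.sum_congr rfl fun i _ => Finset.sum_congr rfl fun k _ => ?_
    rw [hμ k]
  refine decAtT_finite_mixture x _ j' (M₁ + M₂) _ lam (fun r => lconv M₁ M₂ μ₁ (fun k => TP[lo r, hi r, gg r, k]))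
    h0 h1 hmix fun r hr => ?_
  have e : lconv M₁ M₂ μ₁ (fun k => TP[lo r, hi r, gg r, k]) = fun h => (1 - gg r) * SH[μ₁, lo r, h] + gg r * SH[μ₁, hi r, h] := by
    funext h; exact lconv_TP M₁ M₂ (lo r) (hi r) μ₁ (gg r) h1M ((hlohi r).trans (hhi r)) (hhi r) h
  rw [e]
  rcases hval r hr with ⟨heq, hS⟩ | ⟨hlt, hj, hxγ⟩ | ⟨hlt, hhij, hxγ, hcr⟩
  · -- (S)-term: the mixture collapses to `shift_k μ₁`
    have e2 : (fun h => (1 - gg r) * SH[μ₁, lo r, h] + gg r * SH[μ₁, hi r, h]) = fun h => SH[μ₁, lo r, h] := by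
      funext h; rw [heq]; ring
    rw [e2]
    exact shift_point_decAtT x T₁ T₂ j' M₁ M₂ (lo r) μ₁ hx0 hx1 h10 h1M h11 ((hlohi r).trans (hhi r)) hμ₁ hS
  · exact shift_giant_decAtT x _ j' M₁ M₂ (lo r) (hi r) μ₁ (gg r) hx0 hx1 h10 h1M h11 ((hlohi r).trans (hhi r)) (hhi r) hj hxγ
      (hgg r).2
  · exact shift_heavyPair_decAtT x T₁ _ j' M₁ M₂ (lo r) (hi r) μ₁ (gg r) hx0 hx1 hlt hhij (hhi r) hxγ (hgg r).2
      (hμ₁ (j' - lo r) (by omega)) (by linarith)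

/-- **AT THE MEANS**: for laws `μ₁, μ₂` (nonnegative, vanishing above their tops, mass 1) with heavy DEC data at their own means
(`μ₁` at every layer `≤ j′`, `μ₂` at `j′`), the convolution is DEC(j′) (`Quant.LawDec.DECAt`). [this work] -/
theorem lconv_decAt_of_hdecAt (x : ℝ) (j' M₁ M₂ : ℕ) (μ₁ μ₂ : ℕ → ℝ) (hx0 : 0 < x) (hx1 : x < 1)
    (h10 : ∀ h, 0 ≤ μ₁ h) (h1M : ∀ h, M₁ < h → μ₁ h = 0) (h11 : ∑ h ∈ Finset.range (M₁ + 1), μ₁ h = 1)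
    (h21 : ∑ h ∈ Finset.range (M₂ + 1), μ₂ h = 1)
    (hμ₁ : ∀ j'', j'' ≤ j' → HDECAtT x (∑ h ∈ Finset.range (M₁ + 1), (h : ℝ) * μ₁ h) j'' M₁ μ₁)
    (hμ₂ : HDECAtT x (∑ h ∈ Finset.range (M₂ + 1), (h : ℝ) * μ₂ h) j' M₂ μ₂) :
    DECAt x j' (M₁ + M₂) (lconv M₁ M₂ μ₁ μ₂) := by
  rw [decAt_iff_decAtT, sum_mul_lconv M₁ M₂ μ₁ μ₂ h11 h21]
  exact lconv_decAtT_of_hdecAtT x _ _ j' M₁ M₂ μ₁ μ₂ hx0 hx1 h10 h1M h11 hμ₁ hμ₂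

end LawDec

end Quant

end Summit.CriticalPhenomena.PercolationContinuityZ3.Theorems
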